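import Summits.BirchSwinnertonDyer.Rank1Residual.Supersingular.SignedLambdaParityTwoMazurTate
import Summits.BirchSwinnertonDyer.Rank1Residual.Supersingular.MazurTateHeckeDescent
import Literature.NumberTheory.EllipticCurves.PAdicLFunctionIntegralityAtTwoProofs
import HarnessLib

/-!
# The BLIND POINT `T = −2` at `p = 2`: the Mazur–Tate functional equation at the second fixed point
# of `ι`, and the value `L♯(−2) = −θ₁(−2) ∈ ℚ` of Sprung's sharp function (cell `b2b-bsdres`, O1
# sub-cell `p = 2`; lens-1 GEN 9 packet B, ported by cc-typer-4 GEN 5 as typer item (27))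

HONEST FRAMING (run/shared/lean/b2b/bsd-rank1-residual/, verbatim in every file): the goal of the
cell is to DELETE the COMBINATION-SHAPED residual classes of the Birch–Swinnerton-Dyer formula for
ALL analytic-rank `≤ 1` elliptic curves over `ℚ` — "full BSD formula for every rank `≤ 1` curve in
class `C`" assembled STRICTLY from published theorems — so that the rank-`≤ 1` remainder becomes
exactly the CONSTRUCTION-SHAPED classes, which are TYPED (missing-input `Prop`s), NOT attempted.
This is not "finishing BSD". THEOREMS ONLY about typed objects (`mazurTateElement`, `IsSprungPair`,
`IsFrickeEigen`); every hypothesis explicit; nothing about any particular curve is asserted; nothing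
booked; no label moves.

CREDIT. This file is the o1 lens-1 GEN 9 packet `HOME/b2b-bsdres-o1-idea-1-g9/lean/G9_BlindPointSharp.lean`
(planner-b2b-bsdres-o1-idea-1-g9-0, 2026-08-21T15:01Z; sha16 of the source `a879de006c66930c`), ported
verbatim up to the namespace (`LensOneG9` dropped) and this paragraph, per the one-writer rule (o1 lead
GEN 21 C159 / R-G21.3, typer item (27)).  This is the finite-level,
typable half (3♯) of lens-1 GEN 8's blind-point route R-L1-G8-B, and it turns GEN 7's 'blind value'
`L♯_E(−2)` (an instrument output, EVIDENCE) into an exact rational: minus the level-1 modular element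
at the quadratic character of `Γ`.

MECHANISM.  At `p = 2` the involution `1+T ↦ (1+T)^{−1}` of the open unit disc has TWO fixed points,
`T = 0` and `T = −2` (Greenberg, LNM 1716, p. 181).  `T = −2` is `1 + T = −1`, the character of
`Γ = 1 + 4ℤ₂` of order `2` (the layer `ℚ(√2)`), a root of `ω_n = (1+T)^{2ⁿ} − 1` for every `n ≥ 1`.  Hence:
* §1 the functional equation `θ_n ≡ σ (1+T)^c θ_n(ι) (mod ω_n)` (tree: `cyclotomicOmega_dvd_mazurTateElement_sub`,
  any prime) CAN be evaluated at `T = −2` although congruences `mod ω_n` are blind there in general: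
  `(1 − σ χ₈(N)) · θ_n(−2) = 0` (`(1+T)^c ↦ (−1)^c = χ₈(N)` by `neg_one_pow_val_eq_chi8`), so
  **`σ · χ₈(N) = −1 ⇒ θ_n(f)(−2) = 0` for all `n ≥ 1`** (`eval_neg_two_mazurTateElement_eq_zero`);
  for `f = f_E` this is the sign `w(E ⊗ χ₈) = w_E χ₈(N) = −1` forcing the Birch sum of `χ₈ = (2/·)` to vanish;
* §2 `θ_1(−2) = 2([1/8]⁺_f − [5/8]⁺_f)` (the `Δ`-doubling `mazurTateElement_two_eq`);
* §3 for ANY Sprung pair `(L♯, L♭)` of `f` at `2` (any `a₂`; the pair is a BINDER `hSP`, inhabited at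
  `2 ∣ a₂`, `2 ∤ N` by the tree's `exists_isSprungPair_two`), the level-1 clause `θ_1 ≡ −L♯ (mod ω_1)`,
  `ω_1 = T(T+2)`, evaluated at `z = −2` (`‖−2‖₂ = 1/2 < 1`, `(1+z)² = 1`; tree: `IsCongrModOmega.eval₂_eq`)
  gives **`L♯(−2) = −θ_1(−2)`** (`tsum_sharp_neg_two_eq`), hence **`σ χ₈(N) = −1 ⇒ L♯(−2) = 0`**
  (`tsum_sharp_neg_two_eq_zero`) — lens-1 GEN 7's law T1 ('`w₈ = −1 ⇒ L♯_E(−2) ≡ 0`', 1 137/1 137,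
  EVIDENCE) as a theorem, with NO `Log`–`ι` law and no completed pair; `L♭(−2)` is invisible at every
  finite level (`v_m(−2) = 0`, §3 `eval_neg_two_flatPoly`), as GEN 8 recorded;
* §4 Hecke descent at the order-2 character: `θ_n(−2) = c_{n−1} · θ_1(−2)` (tree:
  `eval₂_mazurTateElement_eq_mul_of_le` at `ζ = −1`), so no higher layer adds information at `−2`.

References: R. Greenberg, LNM 1716 (1999) p. 181 [GreenbergLNM1716]; B. Mazur, J. Tate, J. Teitelbaum,
Invent. Math. 84 (1986) §I.17 [MazurTateTeitelbaum1986Invent]; F. Sprung, ANT 11 (2017) Cor. 4.4, §1.1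
[Sprung2017]; K. Ota, Amer. J. Math. 140 (2018) Prop. 5.16 [Ota2018].
-/

set_option autoImplicit false

noncomputable section

open scoped Classical MatrixGroups ModularForm

open Polynomial CongruenceSubgroup Literature.NumberTheory.EllipticCurves
  Literature.NumberTheory.EllipticCurves.ModularForms
  Literature.NumberTheory.EllipticCurves.Sprung2017
  Summit.BirchSwinnertonDyer.Rank1Residual.X1.MuLambda

namespace Summit.BirchSwinnertonDyer.Rank1Residual.Supersingular

variable {N : ℕ} [NeZero N] {f : CuspForm (Gamma0 N) 2}

/-! ## §1. The functional equation at the second fixed point `T = −2` -/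

omit [NeZero N] in
/-- `ω_n(−2) = (−1)^{2ⁿ} − 1 = 0` for `n ≥ 1`. [folklore] -/
theorem eval_neg_two_cyclotomicOmega_two {n : ℕ} (hn : 1 ≤ n) :
    ((cyclotomicOmega 2 n).map (Int.castRingHom ℚ)).eval (-2) = 0 := by
  have hev : Even (2 ^ n) := Nat.even_pow.mpr ⟨even_two, by omega⟩
  simp only [cyclotomicOmega, Polynomial.map_sub, Polynomial.map_pow, Polynomial.map_add,
    Polynomial.map_X, Polynomial.map_one, eval_sub, eval_pow, eval_add, eval_X, eval_one]
  norm_num [hev.neg_one_pow]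

omit [NeZero N] in
/-- `(−1)^{2ⁿ − 1} = −1` for `n ≥ 1`. [folklore] -/
theorem neg_one_pow_two_pow_sub_one {n : ℕ} (hn : 1 ≤ n) : (-1 : ℚ) ^ (2 ^ n - 1) = -1 := by
  have hev : Even (2 ^ n) := Nat.even_pow.mpr ⟨even_two, by omega⟩
  have h1 : (-1 : ℚ) ^ (2 ^ n - 1) * (-1) = 1 := by
    rw [← pow_succ, Nat.sub_add_cancel Nat.one_le_two_pow]
    exact hev.neg_one_pow
  linarith

/-- **The Mazur–Tate functional equation at `T = −2`:** `f ∈ S₂(Γ₀(N))` with a Fricke sign `σ = ±1`,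
`2 ∤ N`, `n ≥ 1`: `(1 − σ χ₈(N)) · θ_n(f)(−2) = 0`. [cite: MazurTateTeitelbaum1986Invent, §I.17]
[cite: GreenbergLNM1716, §5 p. 181 (the fixed point −2)] -/
theorem one_sub_mul_eval_neg_two_mazurTateElement {σ : ℤ} (hσ : σ = 1 ∨ σ = -1)
    (hW : IsFrickeEigen N f (-(σ : ℂ))) (hN2 : ¬ 2 ∣ N) {n : ℕ} (hn : 1 ≤ n) :
    (1 - (σ : ℚ) * (ZMod.χ₈ (N : ZMod 8) : ℚ)) * (mazurTateElement f 2 n).eval (-2) = 0 := by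
  haveI : NeZero (2 ^ n) := ⟨pow_ne_zero _ two_ne_zero⟩
  have hσ2 : σ ^ 2 = 1 := by rcases hσ with rfl | rfl <;> norm_num
  obtain ⟨ηN, sN, hN⟩ := exists_classMap_eq_natCast 2 n hN2
  obtain ⟨q, hq⟩ := cyclotomicOmega_dvd_mazurTateElement_sub hσ2 hW n hN
  have hχ := neg_one_pow_val_eq_chi8 hn hN
  -- `(−1)^{(−s_N).val} = (−1)^{s_N.val} = χ₈(N)`
  have hsum : Even ((-sN).val + sN.val) := by
    have h := ZMod.val_add (-sN) sN
    rw [neg_add_cancel, ZMod.val_zero] at h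
    have hdvd : 2 ^ n ∣ (-sN).val + sN.val := Nat.dvd_of_mod_eq_zero h.symm
    exact even_iff_two_dvd.mpr ((dvd_pow_self 2 (by omega)).trans hdvd)
  have hc : (-1 : ℚ) ^ (-sN).val = (ZMod.χ₈ (N : ZMod 8) : ℚ) := by
    have e : (-1 : ℚ) ^ (-sN).val * (-1) ^ sN.val = 1 := by
      rw [← pow_add]; exact hsum.neg_one_pow
    have e2 : ((-1 : ℚ) ^ sN.val) ^ 2 = 1 := by rw [← pow_mul, mul_comm, pow_mul]; norm_num
    have e3 : (-1 : ℚ) ^ (-sN).val = (-1) ^ sN.val := by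
      calc (-1 : ℚ) ^ (-sN).val = (-1) ^ (-sN).val * (((-1) ^ sN.val) ^ 2) := by rw [e2, mul_one]
        _ = ((-1) ^ (-sN).val * (-1) ^ sN.val) * (-1) ^ sN.val := by ring
        _ = (-1) ^ sN.val := by rw [e, one_mul]
    rw [e3, ← hχ]; push_cast; ring
  have h := congr_arg (Polynomial.eval (-2 : ℚ)) hq
  simp only [eval_sub, eval_mul, eval_C, eval_pow, eval_add, eval_X, eval_one, eval_comp,
    eval_neg_two_cyclotomicOmega_two hn, zero_mul] at h
  rw [show (-2 : ℚ) + 1 = -1 by norm_num, neg_one_pow_two_pow_sub_one hn, hc,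
    show (-1 : ℚ) - 1 = -2 by norm_num] at h
  linear_combination h

/-- **`σ · χ₈(N) = −1 ⇒ θ_n(f)(−2) = 0` for every `n ≥ 1`** — the forced zero at the blind point (for
`f = f_E`: `w(E ⊗ χ₈) = −1`). [cite: MazurTateTeitelbaum1986Invent, §I.17] -/
theorem eval_neg_two_mazurTateElement_eq_zero {σ : ℤ} (hσ : σ = 1 ∨ σ = -1)
    (hW : IsFrickeEigen N f (-(σ : ℂ))) (hN2 : ¬ 2 ∣ N) {n : ℕ} (hn : 1 ≤ n)
    (hsign : σ * ZMod.χ₈ (N : ZMod 8) = -1) :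
    (mazurTateElement f 2 n).eval (-2) = 0 := by
  have h := one_sub_mul_eval_neg_two_mazurTateElement hσ hW hN2 hn
  have hs : (σ : ℚ) * (ZMod.χ₈ (N : ZMod 8) : ℚ) = -1 := by exact_mod_cast hsign
  rw [hs] at h
  norm_num at h
  exact h

/-! ## §2. The level-1 element at the blind point -/

/-- **`θ_1(f)(−2) = 2([1/8]⁺_f − [5/8]⁺_f)`**: the level-`8` modular element at the character
`γ = 5 ↦ −1` of `Γ/Γ²` (the `Δ`-doubling `θ_1 = 2[1/8]⁺ + 2[5/8]⁺(1+T)`). [cite: MazurTateTeitelbaum1986Invent, §I.13 (p = 2)] -/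
theorem eval_neg_two_mazurTateElement_one :
    (mazurTateElement f 2 1).eval (-2) =
      2 * (ratPlusSymbol f ((1 : ℚ) / 8) - ratPlusSymbol f ((5 : ℚ) / 8)) := by
  rw [mazurTateElement_two_eq, eval_finsetSum]
  have h8 : (cyclotomicGenerator 2 : ZMod (2 ^ (1 + 2))) = 5 := by
    rw [cyclotomicGenerator_two]; rfl
  rw [show (Finset.univ : Finset (ZMod (2 ^ 1))) = {0, 1} from rfl, Finset.sum_pair (by decide)]
  simp only [eval_mul, eval_C, eval_pow, eval_add, eval_X, eval_one, h8]
  have h0 : ((0 : ZMod (2 ^ 1))).val = 0 := rfl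
  have h1 : ((1 : ZMod (2 ^ 1))).val = 1 := rfl
  rw [h0, h1]
  have h5 : (((5 : ZMod (2 ^ (1 + 2))) ^ 1).val : ℚ) = 5 := by decide
  have h50 : (((5 : ZMod (2 ^ (1 + 2))) ^ 0).val : ℚ) = 1 := by decide
  rw [h5, h50]
  norm_num
  ring

/-! ## §3. The value of `L♯` at the blind point -/

omit [NeZero N] in
/-- `‖−2‖ = 1/2 < 1` in `ℂ₂`. [folklore] -/
theorem norm_neg_two_lt_one : ‖(-2 : ℂ_[2])‖ < 1 := by
  have h : ‖((2 : ℕ) : ℂ_[2])‖ = ((2 : ℕ) : ℝ)⁻¹ := by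
    rw [← map_natCast (algebraMap ℚ_[2] ℂ_[2]) 2]
    exact (PadicComplex.norm_extends' (p := 2) ((2 : ℕ) : ℚ_[2])).trans Padic.norm_p
  have h' : ‖(2 : ℂ_[2])‖ = (2 : ℝ)⁻¹ := by simpa using h
  rw [norm_neg, h']
  norm_num

omit [NeZero N] in
/-- **`L♯(−2) = −θ_1(f)(−2)` for every Sprung pair `(L♯, L♭)` of `f` at `2`** (any `a₂`): the
level-1 clause `θ_1 ≡ −(u_1 L♯ + v_1 L♭) = −L♯ (mod ω_1)`, `ω_1 = T(T + 2)`, evaluated at the root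
`z = −2` of `ω_1` in the open unit disc of `ℂ₂` (`L♯(z) = ∑_k ℓ_k z^k`). [cite: Sprung2017, Cor. 4.4 and §1.1] -/
theorem tsum_sharp_neg_two_eq {ap : ℤ} {Ls Lf : IwasawaAlgebra 2} (hSP : IsSprungPair f 2 ap Ls Lf) :
    ∑' k, ((algebraMap ℚ_[2] ℂ_[2]).comp (algebraMap ℤ_[2] ℚ_[2])) (PowerSeries.coeff k Ls) *
        (-2 : ℂ_[2]) ^ k =
      -algebraMap ℚ ℂ_[2] ((mazurTateElement f 2 1).eval (-2)) := by
  have h := (hSP 1).eval₂_eq norm_neg_two_lt_one (by norm_num)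
  rw [sharpPoly_one, flatPoly_one, map_one, map_zero, one_mul, zero_mul, add_zero,
    show (-2 : ℂ_[2]) = algebraMap ℚ ℂ_[2] (-2) by simp, eval₂_at_apply] at h
  simp only [eval₂_neg, eval₂_one] at h
  rw [show algebraMap ℚ ℂ_[2] (-2) = (-2 : ℂ_[2]) by simp] at h
  linear_combination h

/-- **`σ · χ₈(N) = −1 ⇒ L♯(−2) = 0`** for every Sprung pair of `f` at `2` (`f` with a Fricke sign,
`2 ∤ N`): lens-1 GEN 7's blind-value law T1 as a theorem. [cite: Sprung2017, Cor. 4.4 and §1.1]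
[cite: MazurTateTeitelbaum1986Invent, §I.17] -/
theorem tsum_sharp_neg_two_eq_zero {σ : ℤ} (hσ : σ = 1 ∨ σ = -1)
    (hW : IsFrickeEigen N f (-(σ : ℂ))) (hN2 : ¬ 2 ∣ N) (hsign : σ * ZMod.χ₈ (N : ZMod 8) = -1)
    {ap : ℤ} {Ls Lf : IwasawaAlgebra 2} (hSP : IsSprungPair f 2 ap Ls Lf) :
    ∑' k, ((algebraMap ℚ_[2] ℂ_[2]).comp (algebraMap ℤ_[2] ℚ_[2])) (PowerSeries.coeff k Ls) *
        (-2 : ℂ_[2]) ^ k = 0 := by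
  rw [tsum_sharp_neg_two_eq hSP, eval_neg_two_mazurTateElement_eq_zero hσ hW hN2 le_rfl hsign,
    map_zero, neg_zero]

/-- **In terms of modular symbols: `L♯(−2) = −2([1/8]⁺_f − [5/8]⁺_f)`.** [cite: Sprung2017, Cor. 4.4 and §1.1] -/
theorem tsum_sharp_neg_two_eq_symbols {ap : ℤ} {Ls Lf : IwasawaAlgebra 2}
    (hSP : IsSprungPair f 2 ap Ls Lf) :
    ∑' k, ((algebraMap ℚ_[2] ℂ_[2]).comp (algebraMap ℤ_[2] ℚ_[2])) (PowerSeries.coeff k Ls) *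
        (-2 : ℂ_[2]) ^ k =
      algebraMap ℚ ℂ_[2] (-2 * (ratPlusSymbol f ((1 : ℚ) / 8) - ratPlusSymbol f ((5 : ℚ) / 8))) := by
  rw [tsum_sharp_neg_two_eq hSP, eval_neg_two_mazurTateElement_one, ← map_neg]
  ring_nf

omit [NeZero N] in
/-- **`L♭` is invisible at `−2` at every finite level: `v_m(−2) = 0` for all `m ≥ 1`**
(`v_1 = 0`, `v_2 = −Φ_2(1+T) = −(T+2)`, and the recursion `v_{m+2} = a₂ v_{m+1} − Φ_{2^{m+1}}(1+T) v_m`).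
[cite: Sprung2017, Cor. 4.4] -/
theorem eval_neg_two_flatPoly (ap : ℤ) {m : ℕ} (hm : 1 ≤ m) : (flatPoly ap 2 m).eval (-2) = 0 := by
  -- strong induction via the pair `(v_m(−2), v_{m+1}(−2))`
  have key : ∀ j, (flatPoly ap 2 (j + 1)).eval (-2) = 0 ∧ (flatPoly ap 2 (j + 2)).eval (-2) = 0 := by
    intro j
    induction j with
    | zero =>
      refine ⟨by simp, ?_⟩
      rw [flatPoly_two]
      simp
    | succ j ih =>
      refine ⟨ih.2, ?_⟩
      rw [show j + 1 + 2 = (j + 1) + 2 by ring, flatPoly_add_two, eval_sub, eval_mul, eval_mul,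
        show j + 1 + 1 = j + 2 by ring, ih.2, ih.1, mul_zero, mul_zero, sub_zero]
  obtain ⟨j, rfl⟩ : ∃ j, m = j + 1 := ⟨m - 1, by omega⟩
  exact (key j).1

/-! ## §4. Hecke descent at the order-2 character: `θ_n(−2) = c_{n−1} · θ_1(−2)` -/

omit [NeZero N] in
/-- `−1` is a primitive square root of unity in `ℂ₂`. [folklore] -/
theorem isPrimitiveRoot_neg_one_two : IsPrimitiveRoot (-1 : ℂ_[2]) (2 ^ (0 + 1)) := by
  rw [zero_add, pow_one]
  refine (IsPrimitiveRoot.iff_def (-1 : ℂ_[2]) 2).mpr ⟨by norm_num, fun l hl ↦ ?_⟩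
  rcases Nat.even_or_odd l with hev | hodd
  · exact even_iff_two_dvd.mp hev
  · rw [hodd.neg_one_pow] at hl
    norm_num at hl

/-- **Hecke descent at `T = −2`**: `f` a rational newform of odd level `N`, `a₂(f) = a₂`, `c` the Hecke
descent sequence (`c_0 = 1`, `c_1 = a₂`, `c_{j+2} = a₂ c_{j+1} − 2 c_j`), `n ≥ 1`:
`θ_n(−2) = c_{n−1} · θ_1(−2)` in `ℂ₂`. [cite: MazurTateTeitelbaum1986Invent, §I.10 Prop. (10.2)] -/
theorem eval₂_neg_two_mazurTateElement_eq_mul (hf0 : IsNewform0 f) (hQ : coeffField f = ⊥)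
    (hN2 : ¬ 2 ∣ N) {ap : ℤ} (hap : cuspCoeff f 2 = ap) {n : ℕ} (hn : 1 ≤ n) {c : ℕ → ℤ}
    (hc0 : c 0 = 1) (hc1 : c 1 = ap) (hrec : ∀ j, c (j + 2) = ap * c (j + 1) - 2 * c j) :
    (mazurTateElement f 2 n).eval₂ (algebraMap ℚ ℂ_[2]) (-2) =
      (c (n - 1) : ℂ_[2]) * (mazurTateElement f 2 1).eval₂ (algebraMap ℚ ℂ_[2]) (-2) := by
  have h := eval₂_mazurTateElement_eq_mul_of_le hf0 hQ hN2 hap (show 0 + 1 ≤ n by omega)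
    isPrimitiveRoot_neg_one_two hc0 hc1 (by exact_mod_cast hrec)
  rw [show (-1 : ℂ_[2]) - 1 = -2 by norm_num, zero_add] at h
  exact h

end Summit.BirchSwinnertonDyer.Rank1Residual.Supersingular

end
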